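import Literature.AlgebraicGeometry.HodgeTheory.ChernCharacterBettiUniqueness
import Literature.AlgebraicGeometry.HodgeTheory.FlagBundleSplitting
import Literature.AlgebraicGeometry.HodgeTheory.SurjectivePullbackInjective
import HarnessLib

/-!
# `FlagBundleSplitting` implies `SplittingPrincipleBetti`

Family `hodge`, layer `Literature/AlgebraicGeometry/HodgeTheory`. THEOREMS ONLY (no definition, no
named fact). The tree carries two named facts for Grothendieck's *principe de scindage* on a smooth
projective complex variety `X` and a vector bundle `E` on it:

* `SplittingPrincipleBetti` (`HodgeTheory/ChernCharacterBettiUniqueness` §1, the input of LEMMA U /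
  `IsTwistNormalised.exists_ch_ratio''`): there is `f : Y ⟶ X`, `Y` smooth projective, with `f^*`
  INJECTIVE on `Hⁱ(−(ℂ); ℂ)` for all `i` and `f^*E` flagged;
* `FlagBundleSplitting` (`HodgeTheory/FlagBundleSplitting`, the input of the cycle law
  `ch_mem_algebraicClasses` for arbitrary vector bundles): there is `g : Y ⟶ X`, `Y` smooth projective,
  SURJECTIVE, with `g^*E` flagged.

This file records `splittingPrincipleBetti_of_flagBundleSplitting : FlagBundleSplitting →
SplittingPrincipleBetti` — a surjective morphism of smooth projective complex varieties induces an
injection on complex Betti cohomology (Voisin I, Lemma 7.28; the tree's PROVED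
`complexBetti_map_injective_of_surjective`) — so that ONE construction (the flag bundle `Fl(E) → X`,
Fulton §3.2) discharges both, and consumers of `SplittingPrincipleBetti` may take
`(h : FlagBundleSplitting)` and feed `splittingPrincipleBetti_of_flagBundleSplitting h`.
Nothing here bears on any case of the Hodge conjecture.

## References

* [Fulton1998] W. Fulton, *Intersection Theory*, 2nd ed. (1998), §3.2.
* [Grothendieck1958] A. Grothendieck, *La théorie des classes de Chern*, Bull. SMF 86 (1958), §2.
* [VoisinHodgeI2002] C. Voisin, *Hodge Theory and Complex Algebraic Geometry I* (2002), §7.3.2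
  Lemma 7.28, Lemma 7.32, Thm. 7.33.
-/

noncomputable section

open CategoryTheory AlgebraicGeometry Literature.AlgebraicGeometry.Motives

namespace Literature.AlgebraicGeometry.HodgeTheory

section HodgeTheory

/-- **`FlagBundleSplitting → SplittingPrincipleBetti`**: the flag map `g : Y ⟶ X` of
`FlagBundleSplitting` is surjective between smooth projective complex varieties, hence `g^*` is
injective on `Hⁱ(−(ℂ); ℂ)` for every `i` (Voisin I Lemma 7.28, the tree's
`complexBetti_map_injective_of_surjective`), and `g^*E` has a full flag.
[cite: VoisinHodgeI2002, §7.3.2 Lemma 7.28, Lemma 7.32 and Thm. 7.33] [cite: Fulton1998, §3.2]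
[cite: Grothendieck1958, §2] -/
theorem splittingPrincipleBetti_of_flagBundleSplitting (h : FlagBundleSplitting) :
    SplittingPrincipleBetti := by
  intro n X hX E hE
  obtain ⟨m, Y, g, hY, hg, hflag⟩ := h n X hX E hE
  exact ⟨m, Y, g, hY, fun i ↦ complexBetti_map_injective_of_surjective hX hY g i, hflag⟩

/-- **LEMMA U granted the flag bundle**: for two twist-normalised Chern character theories `C`, `C'`
there is `q ∈ ℚ`, `q ≠ 0`, with `C'.hyperplaneClass N = q • C.hyperplaneClass N` (`N ≥ 1`) and
`C'.chᵢ(E) = qⁱ • C.chᵢ(E)` for every vector bundle `E` on every smooth projective `X/ℂ` and every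
`i ≥ 1` — the tree's `IsTwistNormalised.exists_ch_ratio''` with its hypothesis `SplittingPrincipleBetti`
supplied by `FlagBundleSplitting`. [cite: Grothendieck1958, Thm. 1 (uniqueness) and §2]
[cite: Fulton1984, §4.1] -/
theorem ChernCharacterBetti.IsTwistNormalised.exists_ch_ratio_of_flagBundleSplitting
    (h : FlagBundleSplitting) {C C' : ChernCharacterBetti} (hC : C.IsTwistNormalised)
    (hC' : C'.IsTwistNormalised) :
    ∃ q : ℚ, q ≠ 0 ∧ (∀ N : ℕ, 1 ≤ N → C'.hyperplaneClass N = (q : ℂ) • C.hyperplaneClass N) ∧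
      ∀ {n : ℕ} {X : SchemeOver ℂ}, IsSmoothProjective n X → ∀ (E : X.left.Modules), IsVectorBundle E →
        ∀ {i : ℕ}, 0 < i → C'.ch X E i = (q : ℂ) ^ i • C.ch X E i :=
  ChernCharacterBetti.IsTwistNormalised.exists_ch_ratio'' (splittingPrincipleBetti_of_flagBundleSplitting h)
    hC hC'

end HodgeTheory

end Literature.AlgebraicGeometry.HodgeTheory

end
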